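import Mathlib.Analysis.InnerProductSpace.Basic
import Mathlib.Analysis.SpecialFunctions.Pow.Real
import Mathlib.Analysis.Fourier.FourierTransform
import Literature.NumberTheory.Sieve.RamanujanSum
import HarnessLib

/-!
# Mauduit–Rivat's discrete Fourier transform of a digital function, and the Fourier property (Müllner Def. 4.2), for vector-valued sequences (proved)

Everything in this file is PROVED (plus plain definitions). It sets up, for sequences with
values in a complex normed (resp. inner-product) space `E` — Müllner needs unitary matrices
with the Frobenius norm — the Fourier-analytic vocabulary of C. Mauduit, J. Rivat, *Prime
numbers along Rudin–Shapiro sequences*, J. Eur. Math. Soc. 17 (2015), §2–3, in which C. Müllner,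
*Automatic sequences fulfill the Sarnak conjecture*, Duke Math. J. 166 (2017), §4 states the
second hypothesis of his Thm. 4.4 (Def. 4.2, "uniformly small Fourier transforms"):

* `periodize K f` — MR (5): the `K`-periodic function agreeing with `f` on `[0, K)` (`f_λ` for
  `K = q^λ`), i.e. `n ↦ f(n mod K)`;
* `dftR K F t = K⁻¹ ∑_{u<K} F(u) e(−ut/K)` — MR (24), the discrete Fourier transform at a REAL
  frequency `t`;
* `sum_norm_sq_dftR` — **Parseval, MR (25)**: `∑_{h<K} ‖dftR K F (h + t)‖² = K⁻¹ ∑_{u<K} ‖F u‖²`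
  (inner-product space; `= 1` for unimodular scalar `f`, `= d` for unitary `d × d` matrices);
* `periodize_eq_sum_dftR` — Fourier inversion: `f_K(n) = ∑_{h<K} e(nh/K) dftR K f h`;
* `HasFourierProperty k γ c f` — **Müllner Def. 4.2 = MR Def. 2** for `E`-valued `f`:
  `‖k^{-λ} ∑_{u<k^λ} f(u k^α) e(−ut)‖ ≤ k^{−γ(λ)}` for all `α ≤ cλ`, `t ∈ ℝ` (a property with
  parameters, NOT asserted); `HasFourierProperty.norm_dftR_le` — its instance `α = 0` in the
  `dftR` normalisation: `‖dftR (k^λ) f t‖ ≤ k^{−γ(λ)}`.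

## References
* C. Mauduit, J. Rivat, J. Eur. Math. Soc. 17 (2015) 2595–2642: (5) p. 2597, Def. 2 p. 2597,
  (24)–(26) p. 2602. [MauduitRivat2015]
* C. Müllner, Duke Math. J. 166 (2017), Def. 4.2 (p. 19 of arXiv:1602.03042). [Mullner2017]
-/

noncomputable section

open Finset Complex
open scoped FourierTransform ComplexConjugate InnerProductSpace

namespace Literature.NumberTheory.LFunctions.MauduitRivat

open Literature.NumberTheory.Sieve.RamanujanSum (sum_range_fourierChar_div)

section Periodize

variable {E : Type*}

/-- MR (5): the `K`-periodic function agreeing with `f` on `{0,…,K-1}` (`f_λ` for `K = q^λ`).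
[cite: MauduitRivat2015, (5)] -/
def periodize (K : ℕ) (f : ℕ → E) : ℕ → E := fun n => f (n % K)

/-- Unfolding. [folklore] -/
theorem periodize_apply (K : ℕ) (f : ℕ → E) (n : ℕ) : periodize K f n = f (n % K) := rfl

/-- `f_K = f` on `[0, K)`. [folklore] -/
theorem periodize_of_lt {K : ℕ} (f : ℕ → E) {n : ℕ} (hn : n < K) : periodize K f n = f n := by
  rw [periodize_apply, Nat.mod_eq_of_lt hn]

/-- `f_K` is `K`-periodic. [folklore] -/
theorem periodize_add_mul (K : ℕ) (f : ℕ → E) (n m : ℕ) :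
    periodize K f (n + m * K) = periodize K f n := by
  simp [periodize_apply]

end Periodize

section Normed

variable {E : Type*} [NormedAddCommGroup E] [NormedSpace ℂ E]

/-- `e(a) e(b) = e(a + b)` in `ℂ`. [folklore] -/
theorem coe_fourierChar_mul (a b : ℝ) : (𝐞 a : ℂ) * (𝐞 b : ℂ) = (𝐞 (a + b) : ℂ) := by
  rw [AddChar.map_add_eq_mul, Circle.coe_mul]

/-- MR (24): the discrete Fourier transform at a real frequency,
`dftR K F t = K⁻¹ ∑_{u<K} F(u) e(−ut/K)`. [cite: MauduitRivat2015, (24)] -/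
def dftR (K : ℕ) (F : ℕ → E) (t : ℝ) : E :=
  ((K : ℂ)⁻¹) • ∑ u ∈ range K, (𝐞 (-((u : ℝ) * t / K)) : ℂ) • F u

/-- Unfolding. [folklore] -/
theorem dftR_apply (K : ℕ) (F : ℕ → E) (t : ℝ) :
    dftR K F t = ((K : ℂ)⁻¹) • ∑ u ∈ range K, (𝐞 (-((u : ℝ) * t / K)) : ℂ) • F u := rfl

/-- The transform only sees `F` on `[0, K)`: `dftR K (periodize K f) = dftR K f`. [folklore] -/
theorem dftR_periodize (K : ℕ) (f : ℕ → E) (t : ℝ) : dftR K (periodize K f) t = dftR K f t := by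
  simp only [dftR_apply]
  congr 1
  exact sum_congr rfl fun u hu => by rw [periodize_of_lt f (mem_range.1 hu)]

/-- `|e(x)| = 1`. [folklore] -/
theorem norm_fourierChar (x : ℝ) : ‖(𝐞 x : ℂ)‖ = 1 := Circle.norm_coe _

/-- The trivial bound `‖dftR K F t‖ ≤ K⁻¹ ∑ ‖F u‖`. [folklore] -/
theorem norm_dftR_le (K : ℕ) (F : ℕ → E) (t : ℝ) :
    ‖dftR K F t‖ ≤ (K : ℝ)⁻¹ * ∑ u ∈ range K, ‖F u‖ := by
  rw [dftR_apply, norm_smul, norm_inv, Complex.norm_natCast]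
  gcongr
  refine (norm_sum_le _ _).trans (sum_le_sum fun u _ => ?_)
  rw [norm_smul, norm_fourierChar, one_mul]

/-- **Fourier inversion**: `f_K(n) = ∑_{h<K} e(nh/K) dftR K f h`. [cite: MauduitRivat2015, (24)] -/
theorem periodize_eq_sum_dftR {K : ℕ} (hK : 0 < K) (f : ℕ → E) (n : ℕ) :
    periodize K f n = ∑ h ∈ range K, (𝐞 ((n : ℝ) * h / K) : ℂ) • dftR K f h := by
  have hK0 : (K : ℂ) ≠ 0 := by exact_mod_cast hK.ne'
  -- expand and swap
  have hexp : ∑ h ∈ range K, (𝐞 ((n : ℝ) * h / K) : ℂ) • dftR K f h =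
      ((K : ℂ)⁻¹) • ∑ u ∈ range K,
        (∑ h ∈ range K, (𝐞 ((h : ℝ) * ((n : ℤ) - u : ℤ) / K) : ℂ)) • f u := by
    calc ∑ h ∈ range K, (𝐞 ((n : ℝ) * h / K) : ℂ) • dftR K f h
        = ∑ h ∈ range K, ((K : ℂ)⁻¹) • ∑ u ∈ range K,
            ((𝐞 ((n : ℝ) * h / K) : ℂ) * (𝐞 (-((u : ℝ) * h / K)) : ℂ)) • f u := by
          refine sum_congr rfl fun h _ => ?_
          rw [dftR_apply, smul_comm, smul_sum]
          congr 1
          refine sum_congr rfl fun u _ => ?_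
          rw [← mul_smul]
      _ = ((K : ℂ)⁻¹) • ∑ u ∈ range K,
            (∑ h ∈ range K, (𝐞 ((h : ℝ) * ((n : ℤ) - u : ℤ) / K) : ℂ)) • f u := by
          rw [← smul_sum, sum_comm]
          congr 1
          refine sum_congr rfl fun u _ => ?_
          rw [sum_smul]
          refine sum_congr rfl fun h _ => ?_
          have e : (n : ℝ) * h / K + -((u : ℝ) * h / K) = (h : ℝ) * (((n : ℤ) - u : ℤ) : ℝ) / K := by
            push_cast; ring
          rw [coe_fourierChar_mul, e]
  rw [hexp]
  -- orthogonality: only `u = n % K` survives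
  have horth : ∀ u ∈ range K, (∑ h ∈ range K, (𝐞 ((h : ℝ) * ((n : ℤ) - u : ℤ) / K) : ℂ)) =
      if u = n % K then (K : ℂ) else 0 := by
    intro u hu
    rw [sum_range_fourierChar_div hK.ne']
    have hiff : (K : ℤ) ∣ (n : ℤ) - u ↔ u = n % K := by
      rw [← Nat.modEq_iff_dvd, Nat.ModEq, Nat.mod_eq_of_lt (mem_range.1 hu)]
    by_cases h : u = n % K
    · rw [if_pos (hiff.2 h), if_pos h]
    · rw [if_neg (fun h' => h (hiff.1 h')), if_neg h]
  have hsum : ∑ u ∈ range K, (∑ h ∈ range K, (𝐞 ((h : ℝ) * ((n : ℤ) - u : ℤ) / K) : ℂ)) • f u =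
      (K : ℂ) • f (n % K) := by
    rw [sum_congr rfl fun u hu => by rw [horth u hu]]
    simp only [ite_smul, zero_smul, sum_ite_eq', mem_range, Nat.mod_lt n hK, if_true]
  rw [hsum, smul_smul, inv_mul_cancel₀ hK0, one_smul, periodize_apply]

/-- **Müllner Def. 4.2 = Mauduit–Rivat Def. 2, for `E`-valued sequences** (a property with
parameters, NOT asserted): `f ∈ F_{γ,c}` iff for all `(α, λ)` with `α ≤ cλ` and all real `t`,
`‖k^{-λ} ∑_{u<k^λ} f(u k^α) e(−ut)‖ ≤ k^{−γ(λ)}`. [cite: Mullner2017, Def. 4.2] -/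
def HasFourierProperty (k : ℕ) (γ : ℝ → ℝ) (c : ℝ) (f : ℕ → E) : Prop :=
  ∀ α lam : ℕ, (α : ℝ) ≤ c * lam → ∀ t : ℝ,
    ‖((k : ℝ) ^ lam)⁻¹ • ∑ u ∈ range (k ^ lam), (𝐞 (-((u : ℝ) * t)) : ℂ) • f (u * k ^ α)‖ ≤
      (k : ℝ) ^ (-γ lam)

/-- The instance `α = 0` of the Fourier property in the `dftR` normalisation:
`‖dftR (k^λ) f t‖ ≤ k^{−γ(λ)}` for all real `t` (`c ≥ 0`). [cite: MauduitRivat2015, (7) and (24)] -/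
theorem HasFourierProperty.norm_dftR_le {k : ℕ} {γ : ℝ → ℝ} {c : ℝ} (hc : 0 ≤ c) {f : ℕ → E}
    (hf : HasFourierProperty k γ c f) (lam : ℕ) (t : ℝ) :
    ‖dftR (k ^ lam) f t‖ ≤ (k : ℝ) ^ (-γ lam) := by
  have h := hf 0 lam (by push_cast; exact mul_nonneg hc (Nat.cast_nonneg _)) (t / (k ^ lam : ℕ))
  simp only [pow_zero, mul_one] at h
  rw [dftR_apply]
  have e : ((k ^ lam : ℕ) : ℂ)⁻¹ • ∑ u ∈ range (k ^ lam), (𝐞 (-((u : ℝ) * t / (k ^ lam : ℕ))) : ℂ) • f u =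
      (((k : ℝ) ^ lam)⁻¹ : ℝ) • ∑ u ∈ range (k ^ lam), (𝐞 (-((u : ℝ) * (t / (k ^ lam : ℕ)))) : ℂ) • f u := by
    rw [← Complex.coe_smul]
    congr 1
    · push_cast; rfl
    · refine sum_congr rfl fun u _ => ?_
      rw [mul_div_assoc]
  rw [e]
  exact h

end Normed

section Inner

variable {E : Type*} [NormedAddCommGroup E] [InnerProductSpace ℂ E]

/-- `‖∑_u c_u G_u‖²` expanded through the inner product. [folklore] -/
theorem norm_sum_smul_sq_eq (s : Finset ℕ) (c : ℕ → ℂ) (G : ℕ → E) :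
    ((‖∑ u ∈ s, c u • G u‖ : ℂ) ^ 2) =
      ∑ u ∈ s, ∑ v ∈ s, (conj (c u) * c v) * ⟪G u, G v⟫_ℂ := by
  have h1 : ⟪∑ u ∈ s, c u • G u, ∑ u ∈ s, c u • G u⟫_ℂ = ((‖∑ u ∈ s, c u • G u‖ : ℂ) ^ 2) :=
    inner_self_eq_norm_sq_to_K _
  rw [← h1, sum_inner]
  refine sum_congr rfl fun u _ => ?_
  rw [inner_sum]
  refine sum_congr rfl fun v _ => ?_
  rw [inner_smul_left, inner_smul_right]
  ring

/-- **Parseval for the discrete Fourier transform at shifted integer frequencies**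
(Mauduit–Rivat (25)): `∑_{h<K} ‖dftR K F (h + t)‖² = K⁻¹ ∑_{u<K} ‖F u‖²`.
[cite: MauduitRivat2015, (25)] -/
theorem sum_norm_sq_dftR {K : ℕ} (hK : 0 < K) (F : ℕ → E) (t : ℝ) :
    ∑ h ∈ range K, ‖dftR K F ((h : ℝ) + t)‖ ^ 2 = (K : ℝ)⁻¹ * ∑ u ∈ range K, ‖F u‖ ^ 2 := by
  have hK0 : (K : ℂ) ≠ 0 := by exact_mod_cast hK.ne'
  have hKR : (K : ℝ) ≠ 0 := by exact_mod_cast hK.ne'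
  -- the twisted sequence
  set G : ℕ → E := fun u => (𝐞 (-((u : ℝ) * t / K)) : ℂ) • F u with hG
  have hGnorm : ∀ u, ‖G u‖ = ‖F u‖ := fun u => by
    rw [hG]; simp only; rw [norm_smul, norm_fourierChar, one_mul]
  -- `dftR K F (h + t) = K⁻¹ • ∑_u e(-uh/K) • G u`
  have hsplit : ∀ h : ℕ, dftR K F ((h : ℝ) + t) =
      ((K : ℂ)⁻¹) • ∑ u ∈ range K, (𝐞 (-((u : ℝ) * h / K)) : ℂ) • G u := by
    intro h
    rw [dftR_apply]
    congr 1
    refine sum_congr rfl fun u _ => ?_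
    simp only [hG]
    have e : -((u : ℝ) * ((h : ℝ) + t) / K) = -((u : ℝ) * h / K) + -((u : ℝ) * t / K) := by ring
    rw [← mul_smul, coe_fourierChar_mul, e]
  -- the real identity per frequency: `‖dftR K F (h+t)‖² = K⁻² ‖S_h‖²`
  have hreal : ∀ h : ℕ, ‖dftR K F ((h : ℝ) + t)‖ ^ 2 =
      ((K : ℝ)⁻¹) ^ 2 * ‖∑ u ∈ range K, (𝐞 (-((u : ℝ) * h / K)) : ℂ) • G u‖ ^ 2 := by
    intro h
    rw [hsplit h, norm_smul, mul_pow, norm_inv, Complex.norm_natCast]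
  -- orthogonality
  have horth : ∀ u ∈ range K, ∀ v ∈ range K,
      (∑ h ∈ range K, (𝐞 ((h : ℝ) * ((u : ℤ) - v : ℤ) / K) : ℂ)) = if v = u then (K : ℂ) else 0 := by
    intro u hu v hv
    rw [sum_range_fourierChar_div hK.ne']
    have hu' := mem_range.1 hu
    have hv' := mem_range.1 hv
    have hiff : (K : ℤ) ∣ (u : ℤ) - v ↔ v = u := by
      constructor
      · intro hd
        have := Int.eq_zero_of_abs_lt_dvd hd (by
          rw [abs_lt]; constructor <;> omega)
        omega
      · rintro rfl; simp
    by_cases h : v = u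
    · rw [if_pos (hiff.2 h), if_pos h]
    · rw [if_neg (fun h' => h (hiff.1 h')), if_neg h]
  -- work in `ℂ`
  have key : ((∑ h ∈ range K, ‖dftR K F ((h : ℝ) + t)‖ ^ 2 : ℝ) : ℂ) =
      (((K : ℝ)⁻¹ * ∑ u ∈ range K, ‖F u‖ ^ 2 : ℝ) : ℂ) := by
    rw [sum_congr rfl fun h _ => hreal h]
    push_cast
    calc ∑ h ∈ range K, ((K : ℂ)⁻¹) ^ 2 *
          (‖∑ u ∈ range K, (𝐞 (-((u : ℝ) * h / K)) : ℂ) • G u‖ : ℂ) ^ 2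
        = ∑ h ∈ range K, ((K : ℂ)⁻¹) ^ 2 * ∑ u ∈ range K, ∑ v ∈ range K,
              (conj (𝐞 (-((u : ℝ) * h / K)) : ℂ) * (𝐞 (-((v : ℝ) * h / K)) : ℂ)) * ⟪G u, G v⟫_ℂ := by
          refine sum_congr rfl fun h _ => ?_
          rw [norm_sum_smul_sq_eq]
      _ = ((K : ℂ)⁻¹) ^ 2 * ∑ u ∈ range K, ∑ v ∈ range K,
            (∑ h ∈ range K, (𝐞 ((h : ℝ) * ((u : ℤ) - v : ℤ) / K) : ℂ)) * ⟪G u, G v⟫_ℂ := by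
          rw [← mul_sum, sum_comm]
          congr 1
          refine sum_congr rfl fun u _ => ?_
          rw [sum_comm]
          refine sum_congr rfl fun v _ => ?_
          rw [← sum_mul]
          congr 1
          refine sum_congr rfl fun h _ => ?_
          have e : -(-((u : ℝ) * h / K)) + -((v : ℝ) * h / K) =
              (h : ℝ) * (((u : ℤ) - v : ℤ) : ℝ) / K := by push_cast; ring
          rw [← Circle.coe_inv_eq_conj, ← AddChar.map_neg_eq_inv, coe_fourierChar_mul, e]
      _ = ((K : ℂ)⁻¹) ^ 2 * ∑ u ∈ range K, (K : ℂ) * ⟪G u, G u⟫_ℂ := by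
          congr 1
          refine sum_congr rfl fun u hu => ?_
          rw [sum_congr rfl fun v hv => by rw [horth u hu v hv]]
          simp only [ite_mul, zero_mul, sum_ite_eq', if_pos hu]
      _ = (K : ℂ)⁻¹ * ∑ u ∈ range K, ((‖F u‖ : ℂ) ^ 2) := by
          rw [← mul_sum, ← mul_assoc]
          congr 1
          · field_simp
          · refine sum_congr rfl fun u _ => ?_
            rw [inner_self_eq_norm_sq_to_K, hGnorm]
            norm_cast
  exact_mod_cast key

/-- **Mauduit–Rivat (26)**: if all values have norm `≤ 1` then `∑_h ‖dftR K F (h+t)‖² ≤ 1`, so a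
Fourier property can save at most `k^{-λ/2}` on average — recorded as the mean-square bound.
[cite: MauduitRivat2015, (26)] -/
theorem sum_norm_sq_dftR_le_one {K : ℕ} (hK : 0 < K) {F : ℕ → E} (hF : ∀ u, ‖F u‖ ≤ 1)
    (t : ℝ) : ∑ h ∈ range K, ‖dftR K F ((h : ℝ) + t)‖ ^ 2 ≤ 1 := by
  rw [sum_norm_sq_dftR hK F t]
  have hKR : (0 : ℝ) < K := by exact_mod_cast hK
  rw [inv_mul_le_iff₀ hKR, mul_one]
  calc ∑ u ∈ range K, ‖F u‖ ^ 2 ≤ ∑ _u ∈ range K, (1 : ℝ) :=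
        sum_le_sum fun u _ => by
          have := hF u
          have h0 := norm_nonneg (F u)
          nlinarith
    _ = K := by simp

end Inner

end Literature.NumberTheory.LFunctions.MauduitRivat
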